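/- LEAD seat `ym-line-cbag-p1` (prover-ym-line-cbag-p1-g29-0), LINE 7b (`GlueballBandRecursion`, volume-comparison line): the JET STUB from the crew's
closedness-by-support machinery, down to ONE combinatorial identity — the spatial LIFTING of the kept (closed, connected, `< 4(a−1)`-member) support
classes (`Σ_kept ψ` is `b³ ×` a box-independent rooted sum).  Sorry-free; `--supports stmt-QuantumFields-22957 --as helper`. -/
import Summits.QuantumFields.YangMills.Theorems.GlueballBandRecursionClosedSupportsBox
import Summits.QuantumFields.YangMills.Theorems.GlueballBandRecursionColdDefectComparisonOfJets
import Summits.QuantumFields.YangMills.Theorems.GlueballBandRecursionTraceExcessFloorAllSides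
import HarnessLib

/-!
# Route `GlueballBandRecursion`, line 7b: the cold free-energy jets from the closedness-aware support truncation (composition)

For the periodic box `b×b×b×s` write `log Z(b³×s)(z) = tubeLogZ ρ b s z`, `ψ(A)(z)` for the support functional of a label set `A`
(`Support.pertLogZ_eq_sum_support`), `ℓ(z) = log ∫_G e^{−z(N − Re tr ρ)}` for the one-plaquette logarithm, and, for a size parameter `a ≥ 4`,
`KS_a(b, s)(z) := Σ_{A closed, connected, #A < 4(a−1)} ψ(A)(z)` for the KEPT closed part.  Proved here:

* §1 the rate disc: for `0 < ‖z‖ ≤ r_ρ` the rate `τ = 1 + log(r_ρ/‖z‖) ≥ 1` is admissible (`e^{1+τ}(2M_ρ‖z‖)(D+1)² ≤ 1/2`) and `e^{−τk} = (‖z‖/(e r_ρ))^k`;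
* §2 per box (`b ≥ 2`, `s ≥ 2`, any `a`): `‖log Z(b³×s)(z) − 6b³s·ℓ(z) − KS_a(b,s)(z)‖ ≤ 6b³s·e^{−τ·4(a−1)}` — the crew's closedness-aware truncation
  `Support.norm_pertLogZ_sub_sum_closed_support_le_rate` with the trivial «small» predicate `#A < 4(a−1)` (non-closed classes VANISH by free-bond
  Haar averaging — w3/w4 — so the tail starts at `4(a−1)` plaquettes with no slab count needed at this point), plus the singleton part
  `Support.sum_support_card_eq_one`;
* §3 GIVEN the kept-density identity `KS_a(b,s)/b³ = KS_a(a,s)/a³` (`4 ≤ a ≤ b`, `4 ≤ s` — the crew's LIFTING: closed connected supports with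
  `< 4(a−1)` members root uniquely in every spatial direction at scale `a − 1` by the girth-4 slab count `SlabCount.exists_rooting_of_closed`, each
  class has exactly `b³` spatial translates, and rooted classes transplant between boxes by `BoxSupport.sum_support_sum_eq_of_le`):
  `‖log Z(b³×s)/b³ − log Z(a³×s)/a³‖ ≤ 12s·(‖z‖/(e r_ρ))^{4(a−1)}` on `0 < ‖z‖ ≤ r_ρ`, hence
  `‖coldVolumeDiscrepancy ρ a b t z‖ ≤ 48t·(‖z‖/(e r_ρ))^{4(a−1)}` and `coldVolumeDiscrepancy =O[𝓝 0] z^{3a}` (`4(a−1) ≥ 3a`);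
* §4 `coldFreeEnergyVolumeJets_of_keptDensity` : (kept-density identity for all `G, r, 4 ≤ a ≤ b, 4 ≤ s`) → `ColdFreeEnergyVolumeJets`, and with
  the landed floor (`traceExcessFloorAllSides_holds`, width seat w5) and the finite-currency assembly (`…ColdDefectComparisonOfJets`):
  `coldDoublingRecursionSmallCoupling_of_keptDensity` : (kept-density identity) → `ColdDoublingRecursionSmallCoupling`.

So the ∃-window rung of line 7b hangs on the ONE lifting identity of §3 (being landed by the width seats: `…SupportLifting`, `…ClosedRootingUnique`,
`…SupportInclusion`).

HONEST FRAMING.  Implications/plumbing for a strong-coupling RECORD-type rung; the kept-density identity is a hypothesis here; nothing bears on weak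
coupling or on the Yang–Mills mass gap (Clay), which is NOT proved by anything in this file.
-/

set_option autoImplicit false

noncomputable section

open Filter Topology Asymptotics MeasureTheory Finset
open Literature.Probability.LatticeModels
open Literature.MathematicalPhysics.QuantumFieldTheory
open Literature.MathematicalPhysics.QuantumFieldTheory.Balaban1983to89.Missing

namespace Summit.QuantumFields.YangMills.Theorems.GlueballBandRecursion.Thermal

/-! ## §1 The rate disc -/

section RateDisc

variable {G : Type*} [Group G] {n : ℕ} (ρ : G →* Matrix (Fin n) (Fin n) ℂ)

/-- For `0 < ‖z‖ ≤ r_ρ` the rate `τ = 1 + log(r_ρ/‖z‖)` satisfies `1 ≤ τ`, `‖z‖·M_ρ ≤ 1`, the rate-`τ` smallness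
`e^{1+τ}(2M_ρ‖z‖)(boxDeg 4 + 1)² ≤ 1/2`, and `e^{−τ k} = (‖z‖/(e·r_ρ))^k`. -/
theorem rate_disc {z : ℂ} (hz0 : 0 < ‖z‖) (hz : ‖z‖ ≤ strongCouplingRadius ρ) :
    1 ≤ 1 + Real.log (strongCouplingRadius ρ / ‖z‖) ∧ ‖z‖ * costBound ρ ≤ 1 ∧
      Real.exp (1 + (1 + Real.log (strongCouplingRadius ρ / ‖z‖))) * (2 * costBound ρ * ‖z‖) * ((boxDeg 4 : ℝ) + 1) ^ 2 ≤ 1 / 2 ∧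
      ∀ k : ℕ, Real.exp (-((1 + Real.log (strongCouplingRadius ρ / ‖z‖)) * k)) =
        (‖z‖ / (Real.exp 1 * strongCouplingRadius ρ)) ^ k := by
  have hr0 := strongCouplingRadius_pos ρ
  have hM := costBound_pos ρ
  have hq : 1 ≤ strongCouplingRadius ρ / ‖z‖ := by rw [le_div_iff₀ hz0, one_mul]; exact hz
  have hlog : 0 ≤ Real.log (strongCouplingRadius ρ / ‖z‖) := Real.log_nonneg hq
  refine ⟨by linarith, le_trans (mul_le_mul_of_nonneg_right hz hM.le) (strongCouplingRadius_mul_costBound_le_one ρ), ?_, fun k => ?_⟩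
  · have hexp : Real.exp (1 + (1 + Real.log (strongCouplingRadius ρ / ‖z‖))) = Real.exp 2 * (strongCouplingRadius ρ / ‖z‖) := by
      rw [show (1 : ℝ) + (1 + Real.log (strongCouplingRadius ρ / ‖z‖)) = 2 + Real.log (strongCouplingRadius ρ / ‖z‖) by ring,
        Real.exp_add, Real.exp_log (lt_of_lt_of_le one_pos hq)]
    rw [hexp]
    have h := strongCouplingRadius_smallness ρ
    have heq : Real.exp 2 * (strongCouplingRadius ρ / ‖z‖) * (2 * costBound ρ * ‖z‖) =
        Real.exp 2 * (2 * costBound ρ * strongCouplingRadius ρ) := by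
      field_simp
    calc Real.exp 2 * (strongCouplingRadius ρ / ‖z‖) * (2 * costBound ρ * ‖z‖) * ((boxDeg 4 : ℝ) + 1) ^ 2
        = Real.exp 2 * (2 * costBound ρ * strongCouplingRadius ρ) * ((boxDeg 4 : ℝ) + 1) ^ 2 := by rw [heq]
      _ ≤ 1 / 2 := h
  · rw [show -((1 + Real.log (strongCouplingRadius ρ / ‖z‖)) * k) = (k : ℝ) * (-(1 + Real.log (strongCouplingRadius ρ / ‖z‖))) by ring,
      Real.exp_nat_mul]
    congr 1
    have hpos : 0 < strongCouplingRadius ρ / ‖z‖ := lt_of_lt_of_le one_pos hq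
    rw [neg_add, Real.exp_add, Real.exp_neg, Real.exp_neg, Real.exp_log hpos]
    field_simp

end RateDisc

/-! ## §2 The per-box decomposition: singletons + kept closed classes + tail -/

/-- Splitting a sum over a filter by a disjoint disjunction, for ANY decidability instance on the disjunction (the kept family of the crew's
truncation lemma is `#A = 1 ∨ (closed ∧ connected ∧ small)`, a singleton never being closed). -/
theorem sum_filter_or_of_disjoint {α β : Type*} [DecidableEq α] [AddCommMonoid β] (T : Finset α) (p q : α → Prop) [DecidablePred p]
    [DecidablePred q] (inst : DecidablePred fun x => p x ∨ q x) (hpq : ∀ x, ¬(p x ∧ q x)) (f : α → β) :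
    (∑ x ∈ @Finset.filter α (fun x => p x ∨ q x) inst T, f x) = (∑ x ∈ T.filter p, f x) + ∑ x ∈ T.filter q, f x := by
  rw [← Finset.sum_union]
  · apply Finset.sum_congr _ fun _ _ => rfl
    ext x
    simp only [Finset.mem_filter, Finset.mem_union]
    tauto
  · rw [Finset.disjoint_filter]
    exact fun x _ hp hq => hpq x ⟨hp, hq⟩

section PerBox

variable {G : Type*} [Group G] [TopologicalSpace G] [IsTopologicalGroup G] [CompactSpace G] [MeasurableSpace G] [BorelSpace G]
  {N : ℕ} (ρ : G →* Matrix (Fin N) (Fin N) ℂ)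

open scoped Classical in
/-- **Per box**: for the box `b×b×b×s` (`b, s ≥ 2`), any size parameter `a`, and `z` on the rate-`τ` disc,
`‖log Z(b³×s)(z) − 6b³s·ℓ(z) − KS_a(b,s)(z)‖ ≤ 6b³s·e^{−τ·4(a−1)}` (`ℓ` the one-plaquette logarithm, `KS_a` the kept closed part). -/
theorem norm_tubeLogZ_sub_parts_le (hρ : Continuous ρ) {b s : ℕ} (hb : 2 ≤ b) (hs : 2 ≤ s) (a : ℕ) {z : ℂ}
    (hzM : ‖z‖ * costBound ρ ≤ 1) {τ : ℝ} (hτ : 0 ≤ τ)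
    (hsmall : Real.exp (1 + τ) * (2 * costBound ρ * ‖z‖) * ((boxDeg 4 : ℝ) + 1) ^ 2 ≤ 1 / 2) :
    ‖tubeLogZ ρ b s z - ((b : ℂ) ^ 3 * s * 6) * Complex.log (∫ h, Complex.exp (-(z * (((N : ℝ) - (ρ h).trace.re : ℝ) : ℂ))) ∂haarProbability G) -
        ∑ A ∈ (Finset.univ : Finset (BoxLabel (![b, b, b, s] : Fin 4 → ℕ))).powerset with
          ((∀ p ∈ A, ∀ e ∈ p.bonds, ∃ q ∈ A, q ≠ p ∧ e ∈ q.bonds) ∧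
            IsRConnected (boxSystem (G := G) ρ (![b, b, b, s] : Fin 4 → ℕ)).Adj A ∧ A.card < 4 * (a - 1)),
          ∑ 𝒞 ∈ (rconnSubsets (boxSystem (G := G) ρ (![b, b, b, s] : Fin 4 → ℕ)).Adj A).powerset with 𝒞.biUnion id = A,
            truncatedWeight (GeomInc (boxSystem (G := G) ρ (![b, b, b, s] : Fin 4 → ℕ)).Adj)
              (connActivity (boxSystem (G := G) ρ (![b, b, b, s] : Fin 4 → ℕ)).Adj (zdHaar 4 G)
                ((boxSystem (G := G) ρ (![b, b, b, s] : Fin 4 → ℕ)).weight z)) 𝒞‖ ≤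
      ((b : ℝ) ^ 3 * s * 6) * Real.exp (-(τ * (4 * (a - 1) : ℕ))) := by
  set nb : Fin 4 → ℕ := ![b, b, b, s] with hnb
  have hn : ∀ i, 1 < nb i := by
    intro i; fin_cases i <;> simp [hnb] <;> omega
  set W : Finset (BoxLabel nb) := Finset.univ with hW
  have hWcard : (W.card : ℝ) = (b : ℝ) ^ 3 * s * 6 := by
    rw [hW, Finset.card_univ, hnb, card_boxLabel_four]; push_cast; ring
  have hWcardC : (W.card : ℂ) = (b : ℂ) ^ 3 * s * 6 := by
    rw [hW, Finset.card_univ, hnb, card_boxLabel_four]; push_cast; ring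
  -- the closedness-aware truncation with the kept family `closed ∧ connected ∧ #A < 4(a−1)` (the tail hypothesis is trivial)
  have htrunc := Support.norm_pertLogZ_sub_sum_closed_support_le_rate (d := 4) (G := G) ρ hρ hn hzM hτ hsmall W
    (fun A => A.card < 4 * (a - 1)) (4 * (a - 1)) (fun A _ _ _ hQ => not_lt.1 hQ)
  -- the singleton part
  have hε : 0 ≤ 2 * costBound ρ * ‖z‖ := by have := costBound_pos ρ; positivity
  have hsmall1 := Support.smallness_one_of_rate (D := boxDeg 4) hε hτ hsmall
  have hsing := Support.sum_support_card_eq_one (d := 4) (G := G) ρ hρ hn (r := ‖z‖) hzM hsmall1 W (z := z) le_rfl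
  -- split the kept family: singletons ⊔ (closed ∧ connected ∧ small) — a closed set is never a singleton
  have hpq : ∀ A : Finset (BoxLabel nb), ¬(A.card = 1 ∧ ((∀ p ∈ A, ∀ e ∈ p.bonds, ∃ q ∈ A, q ≠ p ∧ e ∈ q.bonds) ∧
      IsRConnected (boxSystem (G := G) ρ nb).Adj A ∧ A.card < 4 * (a - 1))) := by
    rintro A ⟨h1, h2⟩
    obtain ⟨p, rfl⟩ := Finset.card_eq_one.1 h1
    obtain ⟨e, he⟩ := (boxSystem (G := G) ρ nb).bonds_nonempty p
    obtain ⟨q, hq, hqp, -⟩ := h2.1 p (Finset.mem_singleton_self p) e he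
    exact hqp (Finset.mem_singleton.1 hq)
  rw [sum_filter_or_of_disjoint W.powerset (fun A => A.card = 1)
    (fun A => (∀ p ∈ A, ∀ e ∈ p.bonds, ∃ q ∈ A, q ≠ p ∧ e ∈ q.bonds) ∧
      IsRConnected (boxSystem (G := G) ρ nb).Adj A ∧ A.card < 4 * (a - 1)) _ hpq, hsing, hWcardC, hWcard] at htrunc
  refine le_trans (le_of_eq ?_) htrunc
  unfold tubeLogZ
  rw [sub_sub]

end PerBox

/-! ## §3 The density difference and the cold discrepancy from the kept-density identity -/

section Density

variable {G : Type*} [Group G] [TopologicalSpace G] [IsTopologicalGroup G] [CompactSpace G] [MeasurableSpace G] [BorelSpace G]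
  {N : ℕ} (ρ : G →* Matrix (Fin N) (Fin N) ℂ)

open scoped Classical in
/-- **Density difference from the kept-density identity**: if `KS_a(b,s)(z)/b³ = KS_a(a,s)(z)/a³`, then for `0 < ‖z‖ ≤ r_ρ`
`‖log Z(b³×s)(z)/b³ − log Z(a³×s)(z)/a³‖ ≤ 12s·(‖z‖/(e r_ρ))^{4(a−1)}` (`2 ≤ a ≤ b`, `2 ≤ s`). -/
theorem norm_tubeLogZ_density_sub_le (hρ : Continuous ρ) {a b s : ℕ} (ha : 2 ≤ a) (hab : a ≤ b) (hs : 2 ≤ s) {z : ℂ}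
    (hz0 : 0 < ‖z‖) (hz : ‖z‖ ≤ strongCouplingRadius ρ)
    (hkept :
      (∑ A ∈ (Finset.univ : Finset (BoxLabel (![b, b, b, s] : Fin 4 → ℕ))).powerset with
          ((∀ p ∈ A, ∀ e ∈ p.bonds, ∃ q ∈ A, q ≠ p ∧ e ∈ q.bonds) ∧
            IsRConnected (boxSystem (G := G) ρ (![b, b, b, s] : Fin 4 → ℕ)).Adj A ∧ A.card < 4 * (a - 1)),
          ∑ 𝒞 ∈ (rconnSubsets (boxSystem (G := G) ρ (![b, b, b, s] : Fin 4 → ℕ)).Adj A).powerset with 𝒞.biUnion id = A,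
            truncatedWeight (GeomInc (boxSystem (G := G) ρ (![b, b, b, s] : Fin 4 → ℕ)).Adj)
              (connActivity (boxSystem (G := G) ρ (![b, b, b, s] : Fin 4 → ℕ)).Adj (zdHaar 4 G)
                ((boxSystem (G := G) ρ (![b, b, b, s] : Fin 4 → ℕ)).weight z)) 𝒞) / ((b : ℂ) ^ 3) =
      (∑ A ∈ (Finset.univ : Finset (BoxLabel (![a, a, a, s] : Fin 4 → ℕ))).powerset with
          ((∀ p ∈ A, ∀ e ∈ p.bonds, ∃ q ∈ A, q ≠ p ∧ e ∈ q.bonds) ∧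
            IsRConnected (boxSystem (G := G) ρ (![a, a, a, s] : Fin 4 → ℕ)).Adj A ∧ A.card < 4 * (a - 1)),
          ∑ 𝒞 ∈ (rconnSubsets (boxSystem (G := G) ρ (![a, a, a, s] : Fin 4 → ℕ)).Adj A).powerset with 𝒞.biUnion id = A,
            truncatedWeight (GeomInc (boxSystem (G := G) ρ (![a, a, a, s] : Fin 4 → ℕ)).Adj)
              (connActivity (boxSystem (G := G) ρ (![a, a, a, s] : Fin 4 → ℕ)).Adj (zdHaar 4 G)
                ((boxSystem (G := G) ρ (![a, a, a, s] : Fin 4 → ℕ)).weight z)) 𝒞) / ((a : ℂ) ^ 3)) :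
    ‖tubeLogZ ρ b s z / ((b : ℂ) ^ 3) - tubeLogZ ρ a s z / ((a : ℂ) ^ 3)‖ ≤
      12 * (s : ℝ) * (‖z‖ / (Real.exp 1 * strongCouplingRadius ρ)) ^ (4 * (a - 1)) := by
  obtain ⟨hτ1, hzM, hsmall, hpow⟩ := rate_disc ρ hz0 hz
  set τ : ℝ := 1 + Real.log (strongCouplingRadius ρ / ‖z‖) with hτdef
  set ℓ : ℂ := Complex.log (∫ h, Complex.exp (-(z * (((N : ℝ) - (ρ h).trace.re : ℝ) : ℂ))) ∂haarProbability G) with hℓ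
  have hA := norm_tubeLogZ_sub_parts_le ρ hρ (le_trans ha hab) hs a hzM (by linarith) hsmall
  have hB := norm_tubeLogZ_sub_parts_le ρ hρ ha hs a hzM (by linarith) hsmall
  -- name the kept sums
  set KB := ∑ A ∈ (Finset.univ : Finset (BoxLabel (![b, b, b, s] : Fin 4 → ℕ))).powerset with
      ((∀ p ∈ A, ∀ e ∈ p.bonds, ∃ q ∈ A, q ≠ p ∧ e ∈ q.bonds) ∧
        IsRConnected (boxSystem (G := G) ρ (![b, b, b, s] : Fin 4 → ℕ)).Adj A ∧ A.card < 4 * (a - 1)),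
      ∑ 𝒞 ∈ (rconnSubsets (boxSystem (G := G) ρ (![b, b, b, s] : Fin 4 → ℕ)).Adj A).powerset with 𝒞.biUnion id = A,
        truncatedWeight (GeomInc (boxSystem (G := G) ρ (![b, b, b, s] : Fin 4 → ℕ)).Adj)
          (connActivity (boxSystem (G := G) ρ (![b, b, b, s] : Fin 4 → ℕ)).Adj (zdHaar 4 G)
            ((boxSystem (G := G) ρ (![b, b, b, s] : Fin 4 → ℕ)).weight z)) 𝒞 with hKB
  set KA := ∑ A ∈ (Finset.univ : Finset (BoxLabel (![a, a, a, s] : Fin 4 → ℕ))).powerset with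
      ((∀ p ∈ A, ∀ e ∈ p.bonds, ∃ q ∈ A, q ≠ p ∧ e ∈ q.bonds) ∧
        IsRConnected (boxSystem (G := G) ρ (![a, a, a, s] : Fin 4 → ℕ)).Adj A ∧ A.card < 4 * (a - 1)),
      ∑ 𝒞 ∈ (rconnSubsets (boxSystem (G := G) ρ (![a, a, a, s] : Fin 4 → ℕ)).Adj A).powerset with 𝒞.biUnion id = A,
        truncatedWeight (GeomInc (boxSystem (G := G) ρ (![a, a, a, s] : Fin 4 → ℕ)).Adj)
          (connActivity (boxSystem (G := G) ρ (![a, a, a, s] : Fin 4 → ℕ)).Adj (zdHaar 4 G)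
            ((boxSystem (G := G) ρ (![a, a, a, s] : Fin 4 → ℕ)).weight z)) 𝒞 with hKA
  have ha0 : (0 : ℝ) < a := by exact_mod_cast (show 0 < a by omega)
  have hb0 : (0 : ℝ) < b := by exact_mod_cast (show 0 < b by omega)
  have ha3 : ((a : ℂ) ^ 3) ≠ 0 := pow_ne_zero 3 (by exact_mod_cast (show a ≠ 0 by omega))
  have hb3 : ((b : ℂ) ^ 3) ≠ 0 := pow_ne_zero 3 (by exact_mod_cast (show b ≠ 0 by omega))
  -- the residuals
  set RB : ℂ := tubeLogZ ρ b s z - ((b : ℂ) ^ 3 * s * 6) * ℓ - KB with hRB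
  set RA : ℂ := tubeLogZ ρ a s z - ((a : ℂ) ^ 3 * s * 6) * ℓ - KA with hRA
  have hid : tubeLogZ ρ b s z / ((b : ℂ) ^ 3) - tubeLogZ ρ a s z / ((a : ℂ) ^ 3) = RB / ((b : ℂ) ^ 3) - RA / ((a : ℂ) ^ 3) := by
    have e1 : tubeLogZ ρ b s z = RB + ((b : ℂ) ^ 3 * s * 6) * ℓ + KB := by rw [hRB]; ring
    have e2 : tubeLogZ ρ a s z = RA + ((a : ℂ) ^ 3 * s * 6) * ℓ + KA := by rw [hRA]; ring
    have hb1 : (b : ℂ) ≠ 0 := by exact_mod_cast (show b ≠ 0 by omega)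
    have ha1 : (a : ℂ) ≠ 0 := by exact_mod_cast (show a ≠ 0 by omega)
    have hcb : ((b : ℂ) ^ 3 * s * 6) * ℓ / ((b : ℂ) ^ 3) = (s : ℂ) * 6 * ℓ := by field_simp
    have hca : ((a : ℂ) ^ 3 * s * 6) * ℓ / ((a : ℂ) ^ 3) = (s : ℂ) * 6 * ℓ := by field_simp
    have hk : KB / ((b : ℂ) ^ 3) = KA / ((a : ℂ) ^ 3) := hkept
    rw [e1, e2, add_div, add_div, add_div, add_div, hcb, hca, hk]
    ring
  rw [hid]
  have hRB' : ‖RB‖ ≤ ((b : ℝ) ^ 3 * s * 6) * Real.exp (-(τ * (4 * (a - 1) : ℕ))) := hA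
  have hRA' : ‖RA‖ ≤ ((a : ℝ) ^ 3 * s * 6) * Real.exp (-(τ * (4 * (a - 1) : ℕ))) := hB
  have hexp := hpow (4 * (a - 1))
  rw [hexp] at hRB' hRA'
  calc ‖RB / ((b : ℂ) ^ 3) - RA / ((a : ℂ) ^ 3)‖ ≤ ‖RB / ((b : ℂ) ^ 3)‖ + ‖RA / ((a : ℂ) ^ 3)‖ := norm_sub_le _ _
    _ = ‖RB‖ / (b : ℝ) ^ 3 + ‖RA‖ / (a : ℝ) ^ 3 := by
        rw [norm_div, norm_div, norm_pow, norm_pow, Complex.norm_natCast, Complex.norm_natCast]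
    _ ≤ ((b : ℝ) ^ 3 * s * 6) * (‖z‖ / (Real.exp 1 * strongCouplingRadius ρ)) ^ (4 * (a - 1)) / (b : ℝ) ^ 3 +
          ((a : ℝ) ^ 3 * s * 6) * (‖z‖ / (Real.exp 1 * strongCouplingRadius ρ)) ^ (4 * (a - 1)) / (a : ℝ) ^ 3 := by
        gcongr
    _ = 12 * (s : ℝ) * (‖z‖ / (Real.exp 1 * strongCouplingRadius ρ)) ^ (4 * (a - 1)) := by
        field_simp
        ring

end Density

/-! ## §4 The jet stub and the ∃-window rung from the kept-density identity -/

open scoped Classical in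
/-- **`ColdFreeEnergyVolumeJets` from the kept-density identity.**  If for every compact `G`, faithful unitary `r`, `4 ≤ a ≤ b`, `4 ≤ s` and
`0 < ‖z‖ ≤ r_ρ` the kept closed part of the support expansion is extensive in the spatial volume (`KS_a(b,s)(z)/b³ = KS_a(a,s)(z)/a³` —
the spatial lifting of closed connected supports with `< 4(a−1)` members), then `coldVolumeDiscrepancy r.ρ a b t =O[𝓝 0] z^{3a}` for all
`4 ≤ a ≤ b`, `4 ≤ t` (in fact `‖·‖ ≤ 48t·(‖z‖/(e r_ρ))^{4(a−1)}` on the punctured disc). -/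
theorem coldFreeEnergyVolumeJets_of_keptDensity
    (hkept : ∀ (G : Type) [Group G] [TopologicalSpace G] [IsTopologicalGroup G] [CompactSpace G],
      letI : MeasurableSpace G := borel G
      haveI : BorelSpace G := ⟨rfl⟩
      ∀ (r : LatticeRep G) (a b s : ℕ), 4 ≤ a → a ≤ b → 4 ≤ s → ∀ z : ℂ, 0 < ‖z‖ → ‖z‖ ≤ strongCouplingRadius r.ρ →
        (∑ A ∈ (Finset.univ : Finset (BoxLabel (![b, b, b, s] : Fin 4 → ℕ))).powerset with
            ((∀ p ∈ A, ∀ e ∈ p.bonds, ∃ q ∈ A, q ≠ p ∧ e ∈ q.bonds) ∧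
              IsRConnected (boxSystem (G := G) r.ρ (![b, b, b, s] : Fin 4 → ℕ)).Adj A ∧ A.card < 4 * (a - 1)),
            ∑ 𝒞 ∈ (rconnSubsets (boxSystem (G := G) r.ρ (![b, b, b, s] : Fin 4 → ℕ)).Adj A).powerset with 𝒞.biUnion id = A,
              truncatedWeight (GeomInc (boxSystem (G := G) r.ρ (![b, b, b, s] : Fin 4 → ℕ)).Adj)
                (connActivity (boxSystem (G := G) r.ρ (![b, b, b, s] : Fin 4 → ℕ)).Adj (zdHaar 4 G)
                  ((boxSystem (G := G) r.ρ (![b, b, b, s] : Fin 4 → ℕ)).weight z)) 𝒞) / ((b : ℂ) ^ 3) =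
        (∑ A ∈ (Finset.univ : Finset (BoxLabel (![a, a, a, s] : Fin 4 → ℕ))).powerset with
            ((∀ p ∈ A, ∀ e ∈ p.bonds, ∃ q ∈ A, q ≠ p ∧ e ∈ q.bonds) ∧
              IsRConnected (boxSystem (G := G) r.ρ (![a, a, a, s] : Fin 4 → ℕ)).Adj A ∧ A.card < 4 * (a - 1)),
            ∑ 𝒞 ∈ (rconnSubsets (boxSystem (G := G) r.ρ (![a, a, a, s] : Fin 4 → ℕ)).Adj A).powerset with 𝒞.biUnion id = A,
              truncatedWeight (GeomInc (boxSystem (G := G) r.ρ (![a, a, a, s] : Fin 4 → ℕ)).Adj)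
                (connActivity (boxSystem (G := G) r.ρ (![a, a, a, s] : Fin 4 → ℕ)).Adj (zdHaar 4 G)
                  ((boxSystem (G := G) r.ρ (![a, a, a, s] : Fin 4 → ℕ)).weight z)) 𝒞) / ((a : ℂ) ^ 3)) :
    ColdFreeEnergyVolumeJets := by
  intro G _ _ _ _
  letI : MeasurableSpace G := borel G
  haveI : BorelSpace G := ⟨rfl⟩
  intro r a b t ha hab ht
  have hr0 := strongCouplingRadius_pos r.ρ
  set C : ℝ := 48 * (t : ℝ) / (Real.exp 1 * strongCouplingRadius r.ρ) ^ (4 * (a - 1)) with hC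
  -- the explicit bound on the punctured disc
  have hbound : ∀ z : ℂ, 0 < ‖z‖ → ‖z‖ ≤ strongCouplingRadius r.ρ →
      ‖coldVolumeDiscrepancy r.ρ a b t z‖ ≤ 48 * (t : ℝ) * (‖z‖ / (Real.exp 1 * strongCouplingRadius r.ρ)) ^ (4 * (a - 1)) := by
    intro z hz0 hz
    have h1 := norm_tubeLogZ_density_sub_le r.ρ r.continuous (by omega) hab (by omega) hz0 hz
      (hkept G r a b t ha hab ht z hz0 hz)
    have h2 := norm_tubeLogZ_density_sub_le r.ρ r.continuous (by omega) hab (s := 2 * t) (by omega) hz0 hz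
      (hkept G r a b (2 * t) ha hab (by omega) z hz0 hz)
    have hid : coldVolumeDiscrepancy r.ρ a b t z =
        2 * (tubeLogZ r.ρ b t z / ((b : ℂ) ^ 3) - tubeLogZ r.ρ a t z / ((a : ℂ) ^ 3)) -
          (tubeLogZ r.ρ b (2 * t) z / ((b : ℂ) ^ 3) - tubeLogZ r.ρ a (2 * t) z / ((a : ℂ) ^ 3)) := by
      unfold coldVolumeDiscrepancy coldLogDefect; ring
    rw [hid]
    refine (norm_sub_le _ _).trans ?_
    rw [norm_mul, Complex.norm_ofNat]
    push_cast at h2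
    nlinarith [h1, h2, norm_nonneg (tubeLogZ r.ρ b t z / ((b : ℂ) ^ 3) - tubeLogZ r.ρ a t z / ((a : ℂ) ^ 3))]
  -- `IsBigO z^{3a}` at `0`: on `‖z‖ ≤ min r_ρ 1`, `(‖z‖/(e r))^{4(a−1)} ≤ ‖z‖^{3a}/(e r)^{4(a−1)}`
  refine Asymptotics.IsBigO.of_bound C ?_
  have hnhds : ∀ᶠ z : ℂ in 𝓝 (0 : ℂ), ‖z‖ < min (strongCouplingRadius r.ρ) 1 := by
    have : Metric.ball (0 : ℂ) (min (strongCouplingRadius r.ρ) 1) ∈ 𝓝 (0 : ℂ) :=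
      Metric.ball_mem_nhds _ (lt_min hr0 one_pos)
    filter_upwards [this] with z hz
    rwa [Metric.mem_ball, dist_zero_right] at hz
  filter_upwards [hnhds] with z hz
  have hzr : ‖z‖ ≤ strongCouplingRadius r.ρ := (hz.le.trans (min_le_left _ _))
  have hz1 : ‖z‖ ≤ 1 := hz.le.trans (min_le_right _ _)
  rcases (norm_nonneg z).eq_or_lt with hz0 | hz0
  · -- `z = 0`: everything vanishes
    have hz0' : z = 0 := norm_eq_zero.1 hz0.symm
    subst hz0'
    have : coldVolumeDiscrepancy r.ρ a b t 0 = 0 := by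
      unfold coldVolumeDiscrepancy coldLogDefect tubeLogZ
      simp [Support.pertLogZ_weight_zero]
    rw [this, norm_zero]
    positivity
  · refine (hbound z hz0 hzr).trans ?_
    rw [norm_pow, div_pow, hC]
    have hden : (0 : ℝ) < (Real.exp 1 * strongCouplingRadius r.ρ) ^ (4 * (a - 1)) := by positivity
    have hpow : ‖z‖ ^ (4 * (a - 1)) ≤ ‖z‖ ^ (3 * a) := pow_le_pow_of_le_one hz0.le hz1 (by omega)
    have hre : 48 * (t : ℝ) * (‖z‖ ^ (4 * (a - 1)) / (Real.exp 1 * strongCouplingRadius r.ρ) ^ (4 * (a - 1))) =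
        (48 * (t : ℝ) / (Real.exp 1 * strongCouplingRadius r.ρ) ^ (4 * (a - 1))) * ‖z‖ ^ (4 * (a - 1)) := by ring
    rw [hre]
    exact mul_le_mul_of_nonneg_left hpow (by positivity)

open scoped Classical in
/-- **The ∃-window rung from the kept-density identity**: with the landed floor (`traceExcessFloorAllSides_holds`, width seat w5 g16) and the
finite-currency assembly (`coldDoublingRecursionSmallCoupling_of_coldJets`), `ColdDoublingRecursionSmallCoupling` follows from the kept-density
identity alone.  Only the implication is proved; no mass gap is claimed. -/
theorem coldDoublingRecursionSmallCoupling_of_keptDensity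
    (hkept : ∀ (G : Type) [Group G] [TopologicalSpace G] [IsTopologicalGroup G] [CompactSpace G],
      letI : MeasurableSpace G := borel G
      haveI : BorelSpace G := ⟨rfl⟩
      ∀ (r : LatticeRep G) (a b s : ℕ), 4 ≤ a → a ≤ b → 4 ≤ s → ∀ z : ℂ, 0 < ‖z‖ → ‖z‖ ≤ strongCouplingRadius r.ρ →
        (∑ A ∈ (Finset.univ : Finset (BoxLabel (![b, b, b, s] : Fin 4 → ℕ))).powerset with
            ((∀ p ∈ A, ∀ e ∈ p.bonds, ∃ q ∈ A, q ≠ p ∧ e ∈ q.bonds) ∧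
              IsRConnected (boxSystem (G := G) r.ρ (![b, b, b, s] : Fin 4 → ℕ)).Adj A ∧ A.card < 4 * (a - 1)),
            ∑ 𝒞 ∈ (rconnSubsets (boxSystem (G := G) r.ρ (![b, b, b, s] : Fin 4 → ℕ)).Adj A).powerset with 𝒞.biUnion id = A,
              truncatedWeight (GeomInc (boxSystem (G := G) r.ρ (![b, b, b, s] : Fin 4 → ℕ)).Adj)
                (connActivity (boxSystem (G := G) r.ρ (![b, b, b, s] : Fin 4 → ℕ)).Adj (zdHaar 4 G)
                  ((boxSystem (G := G) r.ρ (![b, b, b, s] : Fin 4 → ℕ)).weight z)) 𝒞) / ((b : ℂ) ^ 3) =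
        (∑ A ∈ (Finset.univ : Finset (BoxLabel (![a, a, a, s] : Fin 4 → ℕ))).powerset with
            ((∀ p ∈ A, ∀ e ∈ p.bonds, ∃ q ∈ A, q ≠ p ∧ e ∈ q.bonds) ∧
              IsRConnected (boxSystem (G := G) r.ρ (![a, a, a, s] : Fin 4 → ℕ)).Adj A ∧ A.card < 4 * (a - 1)),
            ∑ 𝒞 ∈ (rconnSubsets (boxSystem (G := G) r.ρ (![a, a, a, s] : Fin 4 → ℕ)).Adj A).powerset with 𝒞.biUnion id = A,
              truncatedWeight (GeomInc (boxSystem (G := G) r.ρ (![a, a, a, s] : Fin 4 → ℕ)).Adj)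
                (connActivity (boxSystem (G := G) r.ρ (![a, a, a, s] : Fin 4 → ℕ)).Adj (zdHaar 4 G)
                  ((boxSystem (G := G) r.ρ (![a, a, a, s] : Fin 4 → ℕ)).weight z)) 𝒞) / ((a : ℂ) ^ 3)) :
    ColdDoublingRecursionSmallCoupling :=
  coldDoublingRecursionSmallCoupling_of_coldJets (coldFreeEnergyVolumeJets_of_keptDensity hkept) traceExcessFloorAllSides_holds

end Summit.QuantumFields.YangMills.Theorems.GlueballBandRecursion.Thermal

end
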